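import Summits.Ventures.DiscreteObjects.Hadamard.Order167CentralizerFree668
import Summits.Ventures.DiscreteObjects.Hadamard.Order334NegacyclicArray668

/-!
# H(668): centraliser index ≥ 2 at an element of order 167 ⇔ an element of pair order 334 — the Ito / negacyclic line
# (kernel dictionary link)

Framing: lottery ticket; floor = certified bounds/negative ranges.

Cell pub-namedobj (venture DiscreteObjects), target (H), hadamard gen 21.  Completes the `167`-local dictionary of gen 21
(`|C(σ) : ±⟨σ⟩| ∈ {1, 2, 4}`; index `4` = Williamson-type, `Order167WilliamsonType668`) with the middle case.  Let `σ = (π, κ, d, e)` be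
a signed automorphism of a Hadamard matrix of order `668` with `π^167 = κ^167 = 1`, `(π, κ) ≠ (1,1)`.
* **`centralizer167_involution_mul_orderOf`**: if `τ = (π', κ', d', e')` commutes with `σ` and has a non-trivial involution pair, then
  `τσ` has pair order exactly `334` [`(π'π)^334 = 1`; `(π'π)² = π² ≠ 1`; `(π'π)^167 = π' ≠ 1`].
* **`exists_negacyclicArray_of_centralizer167_involution`**: hence (gen 19, `Order334NegacyclicArray668`) `H` is equivalent to a
  Hadamard `2 × 2` array of NEGACYCLIC `±1` blocks of order `334` (the Ito / Williamson–Ito line, family F9).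
* **`order334_sq_and_pow167`** (converse link): an element `g` of pair order `334` yields `σ := g²` of pair exponent `167`,
  non-trivial, and the centralising non-trivial involution pair `g^167`.
So: **∃ H(668) with an element of order 167 whose centraliser has index ≥ 2 over `±⟨σ⟩` ⇔ ∃ H(668) with an element of pair order
334 ⇔ (gen 19) ∃ a Hadamard 2 × 2 negacyclic array of order 668.**  With index `1` = sixteen circulant blocks and index `4` =
Williamson type, the three possible values of the index correspond to the three classical array families.  DICTIONARY only; no
existence claim; H(668) untouched; HITS 0/4.  Ours; no `sorry`, no definitions, default heartbeats.
-/

namespace Summit.Ventures.DiscreteObjects.Hadamard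

open Finset BigOperators Matrix

open Literature.Combinatorics.Designs.GoethalsSeidel (IsHadamardMatrix)

variable {ι : Type*} [Fintype ι] [DecidableEq ι]

section main
variable {H : Matrix ι ι ℤ} (hH : IsHadamardMatrix H) (hι : Fintype.card ι = 668)
  {π κ : Equiv.Perm ι} {d e : ι → ℤ} (haut : IsSignedAut H π κ d e)
include hH hι haut

omit [Fintype ι] [DecidableEq ι] hH hι haut in
/-- a permutation with `π² = 1` and `π^167 = 1` is trivial -/
lemma eq_one_of_sq_of_pow167 {ρ : Equiv.Perm ι} (h2 : ρ ^ 2 = 1) (h167 : ρ ^ 167 = 1) : ρ = 1 := by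
  calc ρ = ρ ^ 167 * ρ := by rw [h167, one_mul]
    _ = ρ ^ 168 := (pow_succ ρ 167).symm
    _ = (ρ ^ 2) ^ 84 := by rw [← pow_mul]
    _ = 1 := by rw [h2, one_pow]

omit [Fintype ι] [DecidableEq ι] hH hι haut in
/-- **a centralising involution times `σ` has pair order `334`** (pure permutation statement). -/
theorem centralizer167_involution_mul_orderOf (hπ : π ^ 167 = 1) (hκ : κ ^ 167 = 1) (hne : π ≠ 1 ∨ κ ≠ 1)
    {π' κ' : Equiv.Perm ι} (hcπ : Commute π' π) (hcκ : Commute κ' κ) (h2 : π' ^ 2 = 1) (h2' : κ' ^ 2 = 1)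
    (hne' : π' ≠ 1 ∨ κ' ≠ 1) : orderOf ((π' * π, κ' * κ) : Equiv.Perm ι × Equiv.Perm ι) = 334 := by
  set X : Equiv.Perm ι × Equiv.Perm ι := (π' * π, κ' * κ) with hX
  have hpow : ∀ n : ℕ, X ^ n = ((π' ^ n * π ^ n, κ' ^ n * κ ^ n) : Equiv.Perm ι × Equiv.Perm ι) := by
    intro n; rw [hX, Prod.pow_mk, hcπ.mul_pow, hcκ.mul_pow]
  have h334 : X ^ 334 = 1 := by
    have e1 : π' ^ 334 = 1 := by rw [show (334 : ℕ) = 2 * 167 by norm_num, pow_mul, h2, one_pow]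
    have e2 : κ' ^ 334 = 1 := by rw [show (334 : ℕ) = 2 * 167 by norm_num, pow_mul, h2', one_pow]
    have e3 : π ^ 334 = 1 := by rw [show (334 : ℕ) = 167 * 2 by norm_num, pow_mul, hπ, one_pow]
    have e4 : κ ^ 334 = 1 := by rw [show (334 : ℕ) = 167 * 2 by norm_num, pow_mul, hκ, one_pow]
    rw [hpow, e1, e2, e3, e4, one_mul]
    rfl
  have hX2 : X ^ 2 ≠ 1 := by
    intro h
    rw [hpow, h2, h2', one_mul, one_mul, Prod.mk_eq_one] at h
    rcases hne with h' | h'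
    · exact h' (eq_one_of_sq_of_pow167 h.1 hπ)
    · exact h' (eq_one_of_sq_of_pow167 h.2 hκ)
  have hX167 : X ^ 167 ≠ 1 := by
    intro h
    rw [hpow, hπ, hκ, mul_one, mul_one, Prod.mk_eq_one] at h
    have e1 : π' ^ 167 = π' := by
      rw [show (167 : ℕ) = 2 * 83 + 1 by norm_num, pow_succ, pow_mul, h2, one_pow, one_mul]
    have e2 : κ' ^ 167 = κ' := by
      rw [show (167 : ℕ) = 2 * 83 + 1 by norm_num, pow_succ, pow_mul, h2', one_pow, one_mul]
    rw [e1, e2] at h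
    rcases hne' with h' | h'
    · exact h' h.1
    · exact h' h.2
  have hdvd : orderOf X ∣ 334 := orderOf_dvd_of_pow_eq_one h334
  have hmem : orderOf X ∈ Nat.divisors 334 := Nat.mem_divisors.mpr ⟨hdvd, by norm_num⟩
  have hdiv : Nat.divisors 334 = {1, 2, 167, 334} := by decide
  rw [hdiv] at hmem
  simp only [Finset.mem_insert, Finset.mem_singleton] at hmem
  rcases hmem with h | h | h | h
  · exfalso; apply hX2; rw [orderOf_dvd_iff_pow_eq_one.mp (by rw [h]; norm_num)]
  · exfalso; exact hX2 (orderOf_dvd_iff_pow_eq_one.mp (by rw [h]))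
  · exfalso; exact hX167 (orderOf_dvd_iff_pow_eq_one.mp (by rw [h]))
  · exact h

/-- **Index ≥ 2 ⇒ the Ito / negacyclic shape**: a centralising signed automorphism of `σ` with non-trivial involution pair makes
`H` equivalent to a Hadamard `2 × 2` array of negacyclic `±1` blocks of order `334` (via gen 19's order-334 dictionary). -/
theorem exists_negacyclicArray_of_centralizer167_involution (hπ : π ^ 167 = 1) (hκ : κ ^ 167 = 1) (hne : π ≠ 1 ∨ κ ≠ 1)
    {π' κ' : Equiv.Perm ι} {d' e' : ι → ℤ} (haut' : IsSignedAut H π' κ' d' e') (hcπ : Commute π' π) (hcκ : Commute κ' κ)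
    (h2 : π' ^ 2 = 1) (h2' : κ' ^ 2 = 1) (hne' : π' ≠ 1 ∨ κ' ≠ 1) :
    ∃ x : Fin 2 → Fin 2 → ZMod 668 → ℤ, (∀ p q r, x p q (r + 334) = -x p q r) ∧
      IsHadamardMatrix (Matrix.of fun (a b : Fin 2 × ZMod 334) => x a.1 b.1 ((b.2.val : ZMod 668) - (a.2.val : ZMod 668))) ∧
      Fintype.card (Fin 2 × ZMod 334) = 668 := by
  have hord := centralizer167_involution_mul_orderOf hπ hκ hne hcπ hcκ h2 h2' hne'
  obtain ⟨hp1, hp2, hq2⟩ := pow_data_of_orderOf hord (a := 2) (by norm_num) (by norm_num)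
  obtain ⟨-, -, hq167⟩ := pow_data_of_orderOf hord (a := 167) (by norm_num) (by norm_num)
  obtain ⟨x, -, hanti, hM, hcard⟩ :=
    exists_negacyclicArray_of_hadamard668_signedAut_334 hH hι (isSignedAut_mul haut' haut) hp1 hp2 hq2 hq167
  exact ⟨x, hanti, hM, hcard⟩

omit [Fintype ι] [DecidableEq ι] hH hι in
/-- **Converse link: an element of pair order 334 gives an element of order 167 with a non-trivial centralising involution.**
For `g = (π, κ, d, e)` of pair order `334`: `σ := g²` has `(π²)^167 = (κ²)^167 = 1`, is non-trivial, and `g^167` is a signed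
automorphism commuting with it whose pair is a non-trivial involution. -/
theorem order334_sq_and_pow167 (hord : orderOf ((π, κ) : Equiv.Perm ι × Equiv.Perm ι) = 334) :
    (π ^ 2) ^ 167 = 1 ∧ (κ ^ 2) ^ 167 = 1 ∧ (π ^ 2 ≠ 1 ∨ κ ^ 2 ≠ 1) ∧
    IsSignedAut H (π ^ 167) (κ ^ 167) (fun i => cyc π d i 167) (fun j => cyc κ e j 167) ∧
    Commute (π ^ 167) (π ^ 2) ∧ Commute (κ ^ 167) (κ ^ 2) ∧
    (π ^ 167) ^ 2 = 1 ∧ (κ ^ 167) ^ 2 = 1 ∧ (π ^ 167 ≠ 1 ∨ κ ^ 167 ≠ 1) := by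
  obtain ⟨hπ, hκ, h2⟩ := pow_data_of_orderOf hord (a := 2) (by norm_num) (by norm_num)
  obtain ⟨-, -, h167⟩ := pow_data_of_orderOf hord (a := 167) (by norm_num) (by norm_num)
  refine ⟨by rw [← pow_mul]; exact hπ, by rw [← pow_mul]; exact hκ, h2, isSignedAut_pow haut 167,
    (Commute.refl π).pow_pow 167 2, (Commute.refl κ).pow_pow 167 2, by rw [← pow_mul]; exact hπ, by rw [← pow_mul]; exact hκ,
    h167⟩

end main

end Summit.Ventures.DiscreteObjects.Hadamard
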